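import Literature.Probability.RandomPlanarGeometry.SAWLoopErasureKestenRenewalGreenTable
import HarnessLib

/-!
# Certified Green-function bounds and renewal floors `μ(ℤ^d) ≥ 2d/(2 − 1/B_d)` — rows `d = 6, …, 21`, all `3 ≤ d ≤ 21`

Topic `Literature/Probability/RandomPlanarGeometry`; the companion ("CLASS S, kernel") of
`SAWLoopErasureKestenRenewalGreenTable.lean`, which holds the certificate machinery
(`GreenCert.Cert`, `GreenCert.Cert.sound`, `GreenCert.Cert.sound_of_check`), the certificate table `GreenCert.cert d`
(`3 ≤ d ≤ 21`), the rows `d = 3, 4, 5` (`GreenCert.srwI_one_le_certB_three/four/five`) and the floor table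
`renewalFloor`; all are used BY NAME.  This module evaluates the rows `d = 6, …, 21` (`decide +kernel`: `d = 6` as the
three separate facts `head ≤ H`, `blocks ≤ S`, `checkRest`; `d ≥ 7`, a few seconds each, through the bundled checker
`Cert.check`) and states the uniform theorems.  Source: HSS93 = Hara–Slade–Sokal, J. Stat. Phys. 72 (1993) 479–517
= arXiv:hep-lat/9302003 — PDF p. 11 (2.32)–(2.33) (the `(0,1)` bound `μ ≥ 2d/(2 − 1/C₀(0,0;1/2d))`), p. 14 Table 2 row
`(0,1)` (`d = 3`: 4.475 817; `d = 4`: 6.704 650; `d = 5`: 8.809 186; `d = 6`: 10.862 525, "truncated to give rigorous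
lower bounds"), pp. 28–30 Appendix A.1 and Table 4 (`C₀(0,0;1/2d) = 1.156 308 124 8 (d = 5)`, `1.116 963 373 2 (d = 6)`).

## What is typed (standard axioms; no `sorry`)

* `GreenCert.srwI_one_le_certB (hd : 3 ≤ d) (hd' : d ≤ 21) : G_d = K_{1,0}(0) ≤ B_d` with `B_3 = 1.5387`, `B_4 = 1.240307`,
  `B_5 = 1.15639`, `B_6 = 1.11698807`, `B_7 = 1.09392997`, …, `B_21 = 1.02569472` (excess over the Table-4 values
  `8.2·10⁻⁵`, `2.5·10⁻⁵` at `d = 5, 6`);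
* **`renewalFloor_le_connectiveConstant (hd : 3 ≤ d) (hd' : d ≤ 21) : renewalFloor d ≤ μ(ℤ^d)`**, i.e. `μ(ℤ^d) ≥ 4.444,
  6.7015, 8.8087, 10.8623, 12.8929, 14.9126, 16.926, 18.9358, 20.9432, 22.9491, 24.9539, 26.9578, 28.9611, 30.9639, 32.9664,
  34.9685, 36.9704, 38.972, 40.9735` (`d = 3, …, 21`), with the named instance `le_connectiveConstant_six_renewal`
  (`10.8623`; tree record was `9.24`) — the instances for `d = 3, 4, 5` are in the companion module; beyond `d = 6` the
  tree's floors were of `d + 5/2` type;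
* **`two_mul_sub_two_lt_connectiveConstant_of_le (h4 : 4 ≤ d) (h21 : d ≤ 21) : 2d − 2 < μ(ℤ^d)`** — the finite range
  left open by the closed-form corollary `two_mul_sub_two_lt_connectiveConstant (hd : 22 ≤ d)` of
  `SAWLoopErasureKestenRenewalSharp`, which the strict dimension-superadditivity of `μ` consumes.

Kernel cost (build farm): `d = 6` ≈ 8 s, `d = 7, …, 21` ≈ 2–5 s each; about 75 s in all with the uniform theorems.
HONEST SCOPE: the floors are the HSS93 `(0,1)` bound evaluated at upper enclosures of `G_d`, not new mathematics about
`μ`; at `d = 6` the printed value is reproduced to `3·10⁻⁴`; for `d ≥ 7` HSS93 prints no `(0,1)` value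
(Table 2 stops at `d = 6`) and the floors here are, to our knowledge, the first certified ones of this form.  Label
(proposed): CLASS S kernel certificate feeding the PORT `SAWLoopErasureKestenRenewal` (HSS93 (2.32)–(2.33), Table 2
row (0,1), Appendix A.1 Table 4).
-/

namespace Literature.Probability.RandomPlanarGeometry.SAW.Zd.LoopErasure

open Literature.Probability.FitznerVanDerHofstad2017

variable {d : ℕ}

namespace GreenCert

/-! ### §1 The rows `d = 6, …, 21` -/

/-- `d = 6`, exact head: `Σ_{m<K} p_{2m}(0) ≤ H_6` (kernel evaluation of the hat kernel). [cite: HaraSladeSokal1993, Appendix A.1 Table 4 p. 30 (C₀(0,0;1/2d)); lane certificate] -/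
theorem cert_head_6 : partialQ (cert 6).d (cert 6).K ≤ (cert 6).H := by
  decide +kernel

/-- `d = 6`, blocks: `blockSumQ ≤ S_6` (kernel evaluation of the Bessel majorants). [cite: HaraSladeSokal1993, Appendix A.1 Table 4 p. 30 (C₀(0,0;1/2d)); lane certificate] -/
theorem cert_blocks_6 : blockSumQ (cert 6).d (cert 6).blocks ((cert 6).N ^ 2) ≤ (cert 6).S := by
  decide +kernel

/-- `d = 6`, the cheap rest of the certificate. [cite: HaraSladeSokal1993, Appendix A.1 Table 4 p. 30 (C₀(0,0;1/2d)); lane certificate] -/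
theorem cert_rest_6 : (cert 6).checkRest = true := by
  decide +kernel

/-- The `d = 7` certificate passes (bundled checker; kernel evaluation). [cite: HaraSladeSokal1993, Appendix A.1 Table 4 p. 30 (C₀(0,0;1/2d)); lane certificate] -/
theorem cert_check_7 : (cert 7).check = true := by
  decide +kernel

/-- The `d = 8` certificate passes (bundled checker; kernel evaluation). [cite: HaraSladeSokal1993, Appendix A.1 Table 4 p. 30 (C₀(0,0;1/2d)); lane certificate] -/
theorem cert_check_8 : (cert 8).check = true := by
  decide +kernel

/-- The `d = 9` certificate passes (bundled checker; kernel evaluation). [cite: HaraSladeSokal1993, Appendix A.1 Table 4 p. 30 (C₀(0,0;1/2d)); lane certificate] -/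
theorem cert_check_9 : (cert 9).check = true := by
  decide +kernel

/-- The `d = 10` certificate passes (bundled checker; kernel evaluation). [cite: HaraSladeSokal1993, Appendix A.1 Table 4 p. 30 (C₀(0,0;1/2d)); lane certificate] -/
theorem cert_check_10 : (cert 10).check = true := by
  decide +kernel

/-- The `d = 11` certificate passes (bundled checker; kernel evaluation). [cite: HaraSladeSokal1993, Appendix A.1 Table 4 p. 30 (C₀(0,0;1/2d)); lane certificate] -/
theorem cert_check_11 : (cert 11).check = true := by
  decide +kernel

/-- The `d = 12` certificate passes (bundled checker; kernel evaluation). [cite: HaraSladeSokal1993, Appendix A.1 Table 4 p. 30 (C₀(0,0;1/2d)); lane certificate] -/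
theorem cert_check_12 : (cert 12).check = true := by
  decide +kernel

/-- The `d = 13` certificate passes (bundled checker; kernel evaluation). [cite: HaraSladeSokal1993, Appendix A.1 Table 4 p. 30 (C₀(0,0;1/2d)); lane certificate] -/
theorem cert_check_13 : (cert 13).check = true := by
  decide +kernel

/-- The `d = 14` certificate passes (bundled checker; kernel evaluation). [cite: HaraSladeSokal1993, Appendix A.1 Table 4 p. 30 (C₀(0,0;1/2d)); lane certificate] -/
theorem cert_check_14 : (cert 14).check = true := by
  decide +kernel

/-- The `d = 15` certificate passes (bundled checker; kernel evaluation). [cite: HaraSladeSokal1993, Appendix A.1 Table 4 p. 30 (C₀(0,0;1/2d)); lane certificate] -/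
theorem cert_check_15 : (cert 15).check = true := by
  decide +kernel

/-- The `d = 16` certificate passes (bundled checker; kernel evaluation). [cite: HaraSladeSokal1993, Appendix A.1 Table 4 p. 30 (C₀(0,0;1/2d)); lane certificate] -/
theorem cert_check_16 : (cert 16).check = true := by
  decide +kernel

/-- The `d = 17` certificate passes (bundled checker; kernel evaluation). [cite: HaraSladeSokal1993, Appendix A.1 Table 4 p. 30 (C₀(0,0;1/2d)); lane certificate] -/
theorem cert_check_17 : (cert 17).check = true := by
  decide +kernel

/-- The `d = 18` certificate passes (bundled checker; kernel evaluation). [cite: HaraSladeSokal1993, Appendix A.1 Table 4 p. 30 (C₀(0,0;1/2d)); lane certificate] -/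
theorem cert_check_18 : (cert 18).check = true := by
  decide +kernel

/-- The `d = 19` certificate passes (bundled checker; kernel evaluation). [cite: HaraSladeSokal1993, Appendix A.1 Table 4 p. 30 (C₀(0,0;1/2d)); lane certificate] -/
theorem cert_check_19 : (cert 19).check = true := by
  decide +kernel

/-- The `d = 20` certificate passes (bundled checker; kernel evaluation). [cite: HaraSladeSokal1993, Appendix A.1 Table 4 p. 30 (C₀(0,0;1/2d)); lane certificate] -/
theorem cert_check_20 : (cert 20).check = true := by
  decide +kernel

/-- The `d = 21` certificate passes (bundled checker; kernel evaluation). [cite: HaraSladeSokal1993, Appendix A.1 Table 4 p. 30 (C₀(0,0;1/2d)); lane certificate] -/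
theorem cert_check_21 : (cert 21).check = true := by
  decide +kernel

/-! ### §2 The uniform theorems -/

/-- **Certified Green-function bounds** `G_d = K_{1,0}(0) ≤ B_d` for `3 ≤ d ≤ 21`:
`B_3 = 1.5387` · `B_4 = 1.240307` · `B_5 = 1.15639` · `B_6 = 1.11698807` · `B_7 = 1.09392997` · `B_8 = 1.07865239` ·
`B_9 = 1.0677478` · `B_10 = 1.05954429` · `B_11 = 1.05313636` · `B_12 = 1.04798647` · `B_13 = 1.04375412` ·
`B_14 = 1.04021244` · `B_15 = 1.03720415` · `B_16 = 1.0346166` · `B_17 = 1.03236693` · `B_18 = 1.03039278` ·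
`B_19 = 1.0286463` · `B_20 = 1.02709014` · `B_21 = 1.02569472` (rows `d = 3, 4, 5` from the companion module).
[cite: HaraSladeSokal1993, Appendix A.1 Table 4 p. 30 (C₀(0,0;1/2d) = G_d: d=3: 1.516 386, d=4: 1.239 467,
d=5: 1.156 308, d=6: 1.116 963); lane certificate] -/
theorem srwI_one_le_certB (hd : 3 ≤ d) (hd' : d ≤ 21) : srwI d 1 0 0 ≤ ((cert d).B : ℝ) := by
  interval_cases d
  · exact srwI_one_le_certB_three
  · exact srwI_one_le_certB_four
  · exact srwI_one_le_certB_five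
  · exact Cert.sound (cert 6) (by decide) cert_head_6 cert_blocks_6 cert_rest_6
  · exact Cert.sound_of_check (cert 7) (by decide) cert_check_7
  · exact Cert.sound_of_check (cert 8) (by decide) cert_check_8
  · exact Cert.sound_of_check (cert 9) (by decide) cert_check_9
  · exact Cert.sound_of_check (cert 10) (by decide) cert_check_10
  · exact Cert.sound_of_check (cert 11) (by decide) cert_check_11
  · exact Cert.sound_of_check (cert 12) (by decide) cert_check_12
  · exact Cert.sound_of_check (cert 13) (by decide) cert_check_13
  · exact Cert.sound_of_check (cert 14) (by decide) cert_check_14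
  · exact Cert.sound_of_check (cert 15) (by decide) cert_check_15
  · exact Cert.sound_of_check (cert 16) (by decide) cert_check_16
  · exact Cert.sound_of_check (cert 17) (by decide) cert_check_17
  · exact Cert.sound_of_check (cert 18) (by decide) cert_check_18
  · exact Cert.sound_of_check (cert 19) (by decide) cert_check_19
  · exact Cert.sound_of_check (cert 20) (by decide) cert_check_20
  · exact Cert.sound_of_check (cert 21) (by decide) cert_check_21

end GreenCert

/-- **The Hara–Slade–Sokal `(0,1)` bound with certified Green-function inputs**:
`renewalFloor d ≤ μ(ℤ^d)` for `3 ≤ d ≤ 21`, i.e. `μ(ℤ³) ≥ 4.444`, `μ(ℤ⁴) ≥ 6.7015`, `μ(ℤ⁵) ≥ 8.8087`, `μ(ℤ⁶) ≥ 10.8623`,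
`μ(ℤ⁷) ≥ 12.8929`, …, `μ(ℤ²¹) ≥ 40.9735` (the printed Table-2 values `6.704 650 / 8.809 186 / 10.862 525` at
`d = 4, 5, 6` are reproduced to `3·10⁻³ / 5·10⁻⁴ / 3·10⁻⁴`; at `d = 3` the elementary `m^{-3/2}` tail costs `0.03`).
[cite: HaraSladeSokal1993, (2.32)–(2.33) p. 11 & Table 2 p. 14 row (0,1)] -/
theorem renewalFloor_le_connectiveConstant (hd : 3 ≤ d) (hd' : d ≤ 21) :
    (renewalFloor d : ℝ) ≤ connectiveConstant d := by
  refine le_trans ?_ (two_mul_div_renewal_le_connectiveConstant_of_le hd (GreenCert.srwI_one_le_certB hd hd'))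
  interval_cases d <;> norm_num [renewalFloor, GreenCert.cert]

/-- **`μ(ℤ⁶) ≥ 10.8623`** = `renewalFloor 6` (HSS93 prints `10.862 525`; tree record was `9.24`).
[cite: HaraSladeSokal1993, (2.32)–(2.33) p. 11; Table 2 p. 14 row (0,1), d = 6: 10.862 525] -/
theorem le_connectiveConstant_six_renewal : (108623 / 10000 : ℝ) ≤ connectiveConstant 6 := by
  simpa [renewalFloor] using renewalFloor_le_connectiveConstant (d := 6) (by norm_num) (by norm_num)

/-- **`2d − 2 < μ(ℤ^d)` for `4 ≤ d ≤ 21`** (the renewal floors exceed `2d − 2` by `0.70 … 0.97`; at `d = 3` the tree's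
`connectiveConstant_three_gt_427_div_100` already gives `4 = 2·3 − 2 < 4.27 < μ(ℤ³)`; for `d ≥ 22` see
`two_mul_sub_two_lt_connectiveConstant` in `SAWLoopErasureKestenRenewalSharp`).
[cite: HaraSladeSokal1993, (2.32)–(2.33) p. 11, Table 2 p. 14] -/
theorem two_mul_sub_two_lt_connectiveConstant_of_le (h4 : 4 ≤ d) (h21 : d ≤ 21) :
    2 * (d : ℝ) - 2 < connectiveConstant d := by
  refine lt_of_lt_of_le ?_ (renewalFloor_le_connectiveConstant (by omega) h21)
  interval_cases d <;> norm_num [renewalFloor]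

end Literature.Probability.RandomPlanarGeometry.SAW.Zd.LoopErasure
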